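import Summits.QuantumFields.YangMills.Theorems.SwapVirialDeficitZeroModeGroupFourSmallBallDecaySet
import Mathlib.Analysis.SpecialFunctions.JapaneseBracket
import Literature.Analysis.Complex.ExtremalLength
import HarnessLib

/-!
# Exact zero-mode rung, FOUR pairwise nearly commuting letters — VIII-b: the scaled profile and the squared cut-fibre bound (toward the uniform decay, VIII-c)
# (zero-mode block of crux ⟨stmt-QuantumFields-24497⟩ `ToronTubeVolumeLaw`; free-hands support of ⟨stmt-QuantumFields-24197⟩ / ⟨24497⟩)

Ingredients of ★★★ `volume_twoScaleSet4_le_decay` (part VIII-c: `vol³(T(η, ζ, κ)) ≤ C·(κ^{1/4})⁻¹` for ALL `η, ζ ≥ 0`, `κ > 0`).  In the radial formula of part VII (`κ = t²(a₀²+ρ²)²/(4ρ⁴)`) this is `≲ ρ/√t`: integrable against `dρ/ρ` on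
`ρ ≲ √t` uniformly in `t` — the lower cut-off of the logarithm and the deep region in one estimate.  Mechanism: over the reference letter `x`
(largest transverse size `ρ_x`) each other letter lies in the cut fibre `fibreK κ x` of part VIII-a, of volume `v ≤ 16√2·m`, `m = min(ρ_x, 1/|x_I|)`,
AND `v ≤ 16√2/(ρ_x√κ)`; hence `v² ≤ a√(ab) = 512·m√m/(√ρ_x·κ^{1/4})` (§29), and `∫ m√m dx_I = C₁√ρ_x` EXACTLY by scaling (§28,
`C₁ = ∫ n√n`, `n = min(1, 1/|u|)`, finite by comparison with `(1 + |u|)^{-3/2}`), so `√ρ_x` cancels (the `x`-integral is assembled in VIII-c).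
HONEST LABEL: finite-dimensional measure theory on `SU(2)⁴` (plan-level zero-mode rung of DRAFT lines); NOT ⟨24497⟩, NOT ⟨24197⟩; the Yang–Mills mass gap
is NOT proved; no summit is proved by a line.  Seat ym-line-fcl-p3 g44 (cell ym-idea-1, free hands), `--supports stmt-QuantumFields-24197`.  Standard axioms
(auxiliary defs `nfun`, `C1`, `mfun`).  References: [cite: GonzalezarroyoAltes1988]; [cite: Vanbaal2001]; [folklore].
-/

set_option autoImplicit false

noncomputable section

open MeasureTheory Quaternion Set Real
open scoped Quaternion ENNReal BigOperators
open Literature.MathematicalPhysics.QuantumLattice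
open Literature.Analysis.Complex.ExtremalLength (lintegral_comp_mul_left_of_pos)
open Summit.QuantumFields.YangMills.Theorems.SwapTwistDeficit.ToronLog

attribute [local instance] Literature.Analysis.FluidPDE.Tao2016.quatMeasurableSpace
  Literature.Analysis.FluidPDE.Tao2016.quatBorelSpace
  Literature.MathematicalPhysics.QuantumLattice.secondCountableTopology_su2

namespace Summit.QuantumFields.YangMills.Theorems.SwapVirialDeficit.ZeroModeGroup

/-! ## §28 The profile `n(u) = min(1, 1/|u|)`, the constant `C₁ = ∫ n√n < ∞`, and the scaled profile -/

/-- `n(u) = min(1, 1/|u|)` (as a case split, avoiding `1/0`). [folklore] -/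
def nfun (u : ℝ) : ℝ := if |u| ≤ 1 then 1 else 1 / |u|

/-- `0 ≤ n ≤ 1`. [folklore] -/
theorem nfun_nonneg_le_one (u : ℝ) : 0 ≤ nfun u ∧ nfun u ≤ 1 := by
  unfold nfun
  split_ifs with h
  · exact ⟨zero_le_one, le_rfl⟩
  · have hu : 1 < |u| := not_le.1 h
    exact ⟨by positivity, by rw [div_le_one (by linarith)]; exact hu.le⟩

/-- `n` is measurable. [folklore] -/
theorem measurable_nfun : Measurable nfun := by
  unfold nfun
  exact Measurable.ite (measurableSet_le measurable_id.abs measurable_const) measurable_const (measurable_const.div measurable_id.abs)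

/-- `n(u) ≤ 2/(1 + |u|)`. [folklore] -/
theorem nfun_le_two_div (u : ℝ) : nfun u ≤ 2 / (1 + |u|) := by
  have ha : 0 ≤ |u| := abs_nonneg u
  unfold nfun
  split_ifs with h
  · rw [le_div_iff₀ (by positivity)]; linarith
  · have hu : 1 < |u| := not_le.1 h
    rw [div_le_div_iff₀ (by positivity) (by positivity)]; linarith

/-- `n√n ≤ 2√2·(1 + |u|)^{-3/2}`. [folklore] -/
theorem nfun_mul_sqrt_le (u : ℝ) : nfun u * Real.sqrt (nfun u) ≤ 2 * Real.sqrt 2 * (1 + |u|) ^ (-(3 / 2 : ℝ)) := by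
  obtain ⟨hn0, -⟩ := nfun_nonneg_le_one u
  have hb : 0 < 1 + |u| := by positivity
  have h1 := nfun_le_two_div u
  have h2 : Real.sqrt (nfun u) ≤ Real.sqrt (2 / (1 + |u|)) := Real.sqrt_le_sqrt h1
  have h3 : nfun u * Real.sqrt (nfun u) ≤ 2 / (1 + |u|) * Real.sqrt (2 / (1 + |u|)) :=
    mul_le_mul h1 h2 (Real.sqrt_nonneg _) (by positivity)
  refine h3.trans (le_of_eq ?_)
  -- `2/(1+|u|)·√(2/(1+|u|)) = 2√2·(1+|u|)^{-3/2}`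
  have e1 : (1 + |u|) ^ (-(3 / 2 : ℝ)) = ((1 + |u|) * Real.sqrt (1 + |u|))⁻¹ := by
    rw [Real.rpow_neg hb.le, show (3 / 2 : ℝ) = 1 + 1 / 2 by norm_num, Real.rpow_add hb, Real.rpow_one, Real.sqrt_eq_rpow]
  rw [e1, Real.sqrt_div (by norm_num : (0:ℝ) ≤ 2)]
  have hs : Real.sqrt (1 + |u|) ≠ 0 := (Real.sqrt_pos.2 hb).ne'
  field_simp

/-- The constant `C₁ = ∫ n(u)√n(u) du` (`= 6`, but only its finiteness is used). [folklore] -/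
def C1 : ℝ≥0∞ := ∫⁻ u : ℝ, ENNReal.ofReal (nfun u * Real.sqrt (nfun u))

/-- ★ `C₁ < ∞` (comparison with the integrable `(1 + |u|)^{-3/2}`, Mathlib `integrable_one_add_norm`). [folklore] -/
theorem C1_lt_top : C1 < ⊤ := by
  have hint : Integrable (fun u : ℝ => (1 + ‖u‖) ^ (-(3 / 2 : ℝ))) := integrable_one_add_norm (by norm_num [Module.finrank_self])
  have hfin := hint.2
  unfold HasFiniteIntegral at hfin
  unfold C1
  calc ∫⁻ u : ℝ, ENNReal.ofReal (nfun u * Real.sqrt (nfun u))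
      ≤ ∫⁻ u : ℝ, ENNReal.ofReal (2 * Real.sqrt 2) * ‖(1 + ‖u‖) ^ (-(3 / 2 : ℝ))‖ₑ := by
        refine lintegral_mono fun u => ?_
        have hnn : 0 ≤ (1 + ‖u‖) ^ (-(3 / 2 : ℝ)) := Real.rpow_nonneg (by positivity) _
        rw [Real.enorm_eq_ofReal hnn, ← ENNReal.ofReal_mul (by positivity)]
        exact ENNReal.ofReal_le_ofReal (by simpa only [Real.norm_eq_abs] using nfun_mul_sqrt_le u)
    _ = ENNReal.ofReal (2 * Real.sqrt 2) * ∫⁻ u : ℝ, ‖(1 + ‖u‖) ^ (-(3 / 2 : ℝ))‖ₑ := by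
        rw [lintegral_const_mul' _ _ ENNReal.ofReal_ne_top]
    _ < ⊤ := ENNReal.mul_lt_top ENNReal.ofReal_lt_top hfin

/-- The scaled profile `m(ξ, ρ) = min(ρ, 1/|ξ|)` (case split). [folklore] -/
def mfun (ξ ρ : ℝ) : ℝ := if |ξ| * ρ ≤ 1 then ρ else 1 / |ξ|

/-- `m ≥ 0` for `ρ ≥ 0`. [folklore] -/
theorem mfun_nonneg (ξ : ℝ) {ρ : ℝ} (hρ : 0 ≤ ρ) : 0 ≤ mfun ξ ρ := by
  unfold mfun; split_ifs <;> positivity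

/-- Scaling: `m(ξ, ρ) = ρ·n(ρξ)` (`ρ > 0`). [folklore] -/
theorem mfun_eq_mul_nfun {ρ : ℝ} (hρ : 0 < ρ) (ξ : ℝ) : mfun ξ ρ = ρ * nfun (ρ * ξ) := by
  unfold mfun nfun
  rw [abs_mul, abs_of_pos hρ, mul_comm ρ |ξ|]
  split_ifs with h
  · ring
  · have hξ : |ξ| ≠ 0 := by intro h0; rw [h0, zero_mul] at h; exact h zero_le_one
    field_simp

/-- `m(·, ρ)` is measurable. [folklore] -/
theorem measurable_mfun : Measurable fun p : ℝ × ℝ => mfun p.1 p.2 := by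
  unfold mfun
  exact Measurable.ite (measurableSet_le (measurable_fst.abs.mul measurable_snd) measurable_const) measurable_snd
    (measurable_const.div measurable_fst.abs)

/-- ★ **Exact scaling of the `x_I`-integral**: `∫ m(ξ,ρ)√m(ξ,ρ) dξ = √ρ · C₁` (`ρ > 0`). [folklore] -/
theorem lintegral_mfun_sqrt {ρ : ℝ} (hρ : 0 < ρ) :
    ∫⁻ ξ : ℝ, ENNReal.ofReal (mfun ξ ρ * Real.sqrt (mfun ξ ρ)) = ENNReal.ofReal (Real.sqrt ρ) * C1 := by
  have hρs : 0 < Real.sqrt ρ := Real.sqrt_pos.2 hρ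
  have e : ∀ ξ : ℝ, ENNReal.ofReal (mfun ξ ρ * Real.sqrt (mfun ξ ρ)) =
      ENNReal.ofReal (ρ * Real.sqrt ρ) * ENNReal.ofReal (nfun (ρ * ξ) * Real.sqrt (nfun (ρ * ξ))) := by
    intro ξ
    obtain ⟨hn0, -⟩ := nfun_nonneg_le_one (ρ * ξ)
    rw [mfun_eq_mul_nfun hρ, ← ENNReal.ofReal_mul (by positivity), Real.sqrt_mul hρ.le]
    congr 1; ring
  simp_rw [e]
  rw [lintegral_const_mul' _ _ ENNReal.ofReal_ne_top]
  have h := lintegral_comp_mul_left_of_pos (fun u : ℝ => ENNReal.ofReal (nfun u * Real.sqrt (nfun u))) hρ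
  rw [h, ← mul_assoc, ← ENNReal.ofReal_mul (by positivity)]
  unfold C1
  congr 2
  field_simp

/-! ## §29 The pointwise bound on the squared cut-fibre volume -/

/-- `vol(fibre4 x) ≤ 16√2·m(x_I, ρ_x)`, `ρ_x = √(tvSq x)`. [folklore] -/
theorem volume_fibre4_le_mfun (x : ℍ) : volume (fibre4 x) ≤ ENNReal.ofReal (16 * Real.sqrt 2 * mfun x.imI (Real.sqrt (tvSq x))) := by
  unfold mfun
  split_ifs with h
  · refine (volume_fibre4_le_sqrt x).trans (ENNReal.ofReal_le_ofReal ?_)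
    have h2 : (1 : ℝ) ≤ Real.sqrt 2 := by rw [← Real.sqrt_one]; exact Real.sqrt_le_sqrt (by norm_num)
    nlinarith [Real.sqrt_nonneg (tvSq x)]
  · have hI : x.imI ≠ 0 := by intro h0; rw [h0, abs_zero, zero_mul] at h; exact h zero_le_one
    refine (volume_fibre4_le_inv hI).trans (le_of_eq ?_)
    congr 1; field_simp

/-- Real algebra: `0 ≤ v ≤ a`, `v ≤ b` imply `v² ≤ a·√(ab)`. [folklore] -/
theorem mul_self_le_of_le_le {v a b : ℝ} (hv : 0 ≤ v) (ha : v ≤ a) (hb : v ≤ b) : v * v ≤ a * Real.sqrt (a * b) := by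
  have ha0 : 0 ≤ a := hv.trans ha
  have h1 : v * v ≤ a * b := mul_le_mul ha hb hv ha0
  have h2 : v ≤ Real.sqrt (a * b) := by rw [← Real.sqrt_mul_self hv]; exact Real.sqrt_le_sqrt h1
  calc v * v ≤ a * v := mul_le_mul_of_nonneg_right ha hv
    _ ≤ a * Real.sqrt (a * b) := mul_le_mul_of_nonneg_left h2 ha0

/-- `√512 = 16√2`. [folklore] -/
theorem sqrt_512 : Real.sqrt 512 = 16 * Real.sqrt 2 := by
  rw [show (512 : ℝ) = 16 ^ 2 * 2 by norm_num, Real.sqrt_mul (by positivity), Real.sqrt_sq (by norm_num)]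

/-- The algebra of the two bounds: `a√(ab) = 512·m√m/(√ρ·√(√κ))` for `a = 16√2m`, `b = 16√2/(ρ√κ)`. [folklore] -/
theorem decay_alg {m ρ κ : ℝ} (hm : 0 ≤ m) (hρ : 0 < ρ) (hκ : 0 < κ) :
    16 * Real.sqrt 2 * m * Real.sqrt (16 * Real.sqrt 2 * m * (16 * Real.sqrt 2 / (ρ * Real.sqrt κ))) =
      512 * (m * Real.sqrt m) / (Real.sqrt ρ * Real.sqrt (Real.sqrt κ)) := by
  have h2 : Real.sqrt 2 * Real.sqrt 2 = 2 := Real.mul_self_sqrt (by norm_num)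
  have hsk : 0 < Real.sqrt κ := Real.sqrt_pos.2 hκ
  have e1 : 16 * Real.sqrt 2 * m * (16 * Real.sqrt 2 / (ρ * Real.sqrt κ)) = 512 * m / (ρ * Real.sqrt κ) := by
    field_simp; nlinarith [h2]
  rw [e1, Real.sqrt_div (by positivity : (0:ℝ) ≤ 512 * m), Real.sqrt_mul (by norm_num : (0:ℝ) ≤ 512), sqrt_512,
    Real.sqrt_mul hρ.le]
  have hsρ : Real.sqrt ρ ≠ 0 := (Real.sqrt_pos.2 hρ).ne'
  have hssk : Real.sqrt (Real.sqrt κ) ≠ 0 := (Real.sqrt_pos.2 hsk).ne'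
  have h2' : Real.sqrt 2 ^ 2 = 2 := Real.sq_sqrt (by norm_num)
  have e2 : 16 * Real.sqrt 2 * m * (16 * Real.sqrt 2 * Real.sqrt m) = 512 * (m * Real.sqrt m) := by
    have e3 : 16 * Real.sqrt 2 * m * (16 * Real.sqrt 2 * Real.sqrt m) = 256 * (Real.sqrt 2 * Real.sqrt 2) * (m * Real.sqrt m) := by ring
    rw [e3, h2]; ring
  rw [← mul_div_assoc, e2]

/-- ★ **Squared cut-fibre bound**: `vol(fibreK κ x)² ≤ 512·m√m/(√ρ_x·κ^{1/4})` (`κ > 0`, `tvSq x > 0`). [folklore] -/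
theorem volume_fibreK_sq_le {κ : ℝ} (hκ : 0 < κ) {x : ℍ} (hpos : 0 < tvSq x) :
    volume (fibreK κ x) * volume (fibreK κ x) ≤
      ENNReal.ofReal (512 * (mfun x.imI (Real.sqrt (tvSq x)) * Real.sqrt (mfun x.imI (Real.sqrt (tvSq x)))) /
        (Real.sqrt (Real.sqrt (tvSq x)) * Real.sqrt (Real.sqrt κ))) := by
  set ρ := Real.sqrt (tvSq x) with hρ
  have hρpos : 0 < ρ := Real.sqrt_pos.2 hpos
  have hm := mfun_nonneg x.imI hρpos.le
  set a : ℝ := 16 * Real.sqrt 2 * mfun x.imI ρ with ha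
  set b : ℝ := 16 * Real.sqrt 2 / (ρ * Real.sqrt κ) with hb
  have ha0 : 0 ≤ a := by rw [ha]; positivity
  have hb0 : 0 ≤ b := by rw [hb]; positivity
  have hva : volume (fibreK κ x) ≤ ENNReal.ofReal a := (measure_mono (fibreK_subset_fibre4 κ x)).trans (volume_fibre4_le_mfun x)
  have hvb : volume (fibreK κ x) ≤ ENNReal.ofReal b := by rw [hb]; exact volume_fibreK_le_kappa hκ hpos
  have hvtop : volume (fibreK κ x) ≠ ⊤ := ne_top_of_le_ne_top ENNReal.ofReal_ne_top hva
  set v := (volume (fibreK κ x)).toReal with hv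
  have hvv : volume (fibreK κ x) = ENNReal.ofReal v := by rw [hv, ENNReal.ofReal_toReal hvtop]
  have hv0 : 0 ≤ v := ENNReal.toReal_nonneg
  have hva' : v ≤ a := by rw [hvv] at hva; exact (ENNReal.ofReal_le_ofReal_iff ha0).1 hva
  have hvb' : v ≤ b := by rw [hvv] at hvb; exact (ENNReal.ofReal_le_ofReal_iff hb0).1 hvb
  rw [hvv, ← ENNReal.ofReal_mul hv0]
  refine ENNReal.ofReal_le_ofReal ((mul_self_le_of_le_le hv0 hva' hvb').trans (le_of_eq ?_))
  rw [ha, hb]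
  exact decay_alg hm hρpos hκ

end Summit.QuantumFields.YangMills.Theorems.SwapVirialDeficit.ZeroModeGroup

end
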